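import Mathlib
import Literature.Geometry.Symplectic.JHolomorphicMap
import Summits.SmoothPoincare4.SmoothPoincare4.Theorems.SullivanDualTameOrBrodyR4AprioriCalculus
import Summits.SmoothPoincare4.SmoothPoincare4.Theorems.SullivanDualTameOrBrodyR4AprioriEnergy
import Summits.SmoothPoincare4.SmoothPoincare4.Theorems.SullivanDualTameOrBrodyR4AprioriBootstrap

/-!
# Stub `stub_aprioriOf` of line `Sketch` for crux `TameOrBrodyR4` (stmt-SmoothPoincare4-7826, route SullivanDual)

The lead's stub: the four analytic inequalities of the worker stubs (`stub_h1Estimate`,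
`stub_ladyzhenskaya`, `stub_supBound`, `stub_normIteratedFDerivLe`) imply the interior a-priori
estimate for entire `C^∞` flat-`J`-holomorphic maps `g : ℂ → ℝ⁴` under a `C¹` bound
(`‖g‖ ≤ R₀`, `‖dg‖ ≤ 2` on the closed unit disc): `‖Dᵏg(0)‖ ≤ C(J, R₀, k)` — elliptic
bootstrapping with `L²` methods only (McDuff–Salamon, *J-holomorphic curves and symplectic
topology* (2012), Thm B.4.2, case `p = ∞`). The proof is assembled in the helper files
`…AprioriCalculus` (word derivatives, commutator identity), `…AprioriSource` (frozen Faà di Bruno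
and source bound), `…AprioriEnergy` (localisation, energy estimate), `…AprioriAlpha/Beta/Gamma`
(the three steps) and `…AprioriBootstrap` (the induction); here only the scale
`δ = 1/(1 + 4M(1+M))` is chosen and the induction is read off at the centre.
-/

noncomputable section

open scoped ContDiff Topology Nat
open Filter Set Literature.Geometry.Symplectic

-- the registered namespace `Summit.SmoothPoincare4.SmoothPoincare4.…` repeats a component
set_option linter.dupNamespace false

namespace Summit.SmoothPoincare4.SmoothPoincare4.Cruxes.TameOrBrodyR4.Sketch

/-- Local notation for the model space `ℝ⁴ = EuclideanSpace ℝ (Fin 4)`. -/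
local notation "E4" => EuclideanSpace ℝ (Fin 4)

section Final

open MeasureTheory Metric

/-- **Stub `stub_aprioriOf` (LEAD; interior a-priori estimate for `J`-holomorphic maps under a
`C¹` bound — elliptic bootstrapping, McDuff–Salamon 2012 Thm B.4.2 for `p = ∞`, flat `ℝ⁴`).**
Assuming the four analytic inequalities of the worker stubs (`H¹` identity, Ladyzhenskaya, sup
bound, basis bound), for every `C^∞` almost complex structure `J` on `ℝ⁴`, every `R₀` and every
order `k` there is a constant `C` such that every entire `C^∞` flat-`J`-holomorphic `g : ℂ → ℝ⁴`
with `‖g‖ ≤ R₀` and `‖dg‖ ≤ 2` on the closed unit disc satisfies `‖D^k g(0)‖ ≤ C`. Proof: with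
`M ≥ ‖J‖, ‖dJ‖` on the ball of radius `R₀` and `δ = 1/(1 + 4M(1+M))` (so `16(1+M²)M²δ² ≤ 1`), the
bootstrapping induction `Apriori.bootstrap` (steps `α, α, β, α, γ` on discs shrinking from `3δ/4`
to `δ/2`) bounds `‖Dⁱg‖` for `i ≤ k + 1` on the disc of radius `r(5k) ∋ 0`. -/
theorem stub_aprioriOf
    (h1 : ∀ (A₀ : E4 →L[ℝ] E4), (∀ v, A₀ (A₀ v) = -v) → ∀ (W : ℂ → E4), ContDiff ℝ ∞ W →
      HasCompactSupport W → (∫ z, (‖fderiv ℝ W z 1‖ ^ 2 + ‖fderiv ℝ W z Complex.I‖ ^ 2)) ≤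
        (1 + ‖A₀‖ ^ 2) * ∫ z, ‖fderiv ℝ W z Complex.I - A₀ (fderiv ℝ W z 1)‖ ^ 2)
    (hL : ∃ C : ℝ, ∀ (W : ℂ → E4), ContDiff ℝ ∞ W → HasCompactSupport W →
      (∫ z, ‖W z‖ ^ 4) ≤ C * ((∫ z, ‖W z‖ ^ 2) *
        ∫ z, (‖fderiv ℝ W z 1‖ ^ 2 + ‖fderiv ℝ W z Complex.I‖ ^ 2)))
    (hS : ∀ (W : ℂ → E4), ContDiff ℝ ∞ W → HasCompactSupport W → ∀ z : ℂ,
      ‖W z‖ ≤ ∫ y, ‖fderiv ℝ (fun x => fderiv ℝ W x 1) y Complex.I‖)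
    (hB : ∀ (n : ℕ) (T : ContinuousMultilinearMap ℝ (fun _ : Fin n => ℂ) E4),
      ‖T‖ ≤ ∑ L : Fin n → Fin 2, ‖T (fun j => ![(1 : ℂ), Complex.I] (L j))‖)
    (J : E4 → E4 →L[ℝ] E4) (hJs : ContDiff ℝ ∞ J) (hJ2 : ∀ x v, J x (J x v) = -v)
    (R₀ : ℝ) (k : ℕ) :
    ∃ C : ℝ, ∀ (g : ℂ → E4), ContDiff ℝ ∞ g → IsJHolomorphicFlat J g →
      (∀ z : ℂ, ‖z‖ ≤ 1 → ‖g z‖ ≤ R₀) → (∀ z : ℂ, ‖z‖ ≤ 1 → ‖fderiv ℝ g z‖ ≤ 2) →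
      ‖iteratedFDeriv ℝ k g 0‖ ≤ C := by
  -- degenerate case `R₀ < 0`
  rcases lt_or_ge R₀ 0 with hR | hR
  · refine ⟨0, fun g _ _ hg0 _ => ?_⟩
    exact absurd ((norm_nonneg (g 0)).trans (hg0 0 (by simp))) (not_le.mpr hR)
  -- bounds for `J` and `dJ` on the ball of radius `R₀`
  obtain ⟨M, hM⟩ := Apriori.exists_bound_iteratedFDeriv hJs R₀ 1
  have hM₀ : ∀ x : E4, ‖x‖ ≤ R₀ → ‖J x‖ ≤ M := fun x hx => by
    have h := hM 0 (Nat.zero_le _) x hx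
    rwa [norm_iteratedFDeriv_zero] at h
  have hM₁ : ∀ x : E4, ‖x‖ ≤ R₀ → ‖fderiv ℝ J x‖ ≤ M := fun x hx => by
    have h := hM 1 le_rfl x hx
    rwa [← norm_iteratedFDeriv_fderiv, norm_iteratedFDeriv_zero] at h
  have hMnn : 0 ≤ M := (norm_nonneg _).trans (hM₀ 0 (by simpa using hR))
  -- the scale `δ`
  obtain ⟨δ, hδdef⟩ : ∃ δ : ℝ, δ = 1 / (1 + 4 * M * (1 + M)) := ⟨_, rfl⟩
  have hD : 1 ≤ 1 + 4 * M * (1 + M) := by nlinarith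
  have hδ0 : 0 < δ := by rw [hδdef]; positivity
  have hδ1 : δ ≤ 1 := by rw [hδdef]; exact div_le_one_of_le₀ hD (by positivity)
  have hδ : 16 * (1 + M ^ 2) * M ^ 2 * δ ^ 2 ≤ 1 := by
    have hx : 4 * M * (1 + M) * δ ≤ 1 := by
      rw [hδdef, mul_one_div]
      exact div_le_one_of_le₀ (by linarith) (by positivity)
    have hx0 : 0 ≤ 4 * M * (1 + M) * δ := by positivity
    have hsq : (4 * M * (1 + M) * δ) ^ 2 ≤ 1 := by nlinarith
    have hcmp : 16 * (1 + M ^ 2) * M ^ 2 * δ ^ 2 ≤ (4 * M * (1 + M) * δ) ^ 2 := by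
      have : 1 + M ^ 2 ≤ (1 + M) ^ 2 := by nlinarith
      have h0 : 0 ≤ 16 * M ^ 2 * δ ^ 2 := by positivity
      nlinarith [mul_le_mul_of_nonneg_left this h0]
    exact hcmp.trans hsq
  obtain ⟨S, hSb⟩ := Apriori.bootstrap h1 hL hS hB hJs hJ2 hM₀ hM₁ hδ0 hδ1 hδ k
  refine ⟨S, fun g hg hgJ hg0 hg1 => hSb g hg hgJ hg0 hg1 k (Nat.le_succ k) 0 ?_⟩
  rw [norm_zero]
  positivity

end Final

end Summit.SmoothPoincare4.SmoothPoincare4.Cruxes.TameOrBrodyR4.Sketch
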